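import Mathlib
import Summits.Ventures.PercRepro2.Defs
import Summits.Ventures.PercRepro2.Graph
import Summits.Ventures.PercRepro2.OneColourSwitch
import Summits.Ventures.PercRepro2.RegionHubSign
import Summits.Ventures.PercRepro2.SideSwitch
import Summits.Ventures.PercRepro2.SideSwitchComps
import Summits.Ventures.PercRepro2.M9NoPocketDefs
import Summits.Ventures.PercRepro2.M9GeneralDHD
import Summits.Ventures.PercRepro2.M9PocketVirtualEdge
import Summits.Ventures.PercRepro2.M9PocketVirtualKonly

/-!
# The outside of a cluster hanging from `{r, s, d}` — its `K`-only points and its virtual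
graphs (blind cell PercRepro2, p3 g42, 2026-08-30; `proofs/P3-POCKETRK.md` §10⁶ (b))

For a graph `G` (the outside `G − F` of the type calculus, but nothing here uses that) and the
OUTSIDE CONDITIONS on a colouring `ω` — `Sep`, `p, q` not `Y`-joined to `d`, no vertex other
than `r, s, d` in both the `Y`-world of the three exits and the `W`-world of `{r, s}`, `d ∉ M₂`
(`Ω₀`): with `d ∈ K₂` of `G` the outside conditions are exactly the `K`-only legal conditions of
`G` (`konly_iff_outside`) and the outside defect is the `W`-defect (`WDefect_iff_outside`);
without that, they are the `K`-only legal conditions of the virtual graph `G + {d, b}`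
(`b ∈ {r, s}`) with the new edge `Y` (`konly_virt_iff_outside`), whose defect is the outside
defect (`M9PocketVirtualKonly`).  When the neighbourhood of `d` separates `r` from `s` in
`G − d`, no `K`-only point has a `W`-link `r ~_W s` (`not_conn_compl_rs_of_sepN`), so `σ_rs` is
the `Y`-link indicator (`sigma_rs_eq_of_sepN`, `sigma_rs_virt_eq_of_sepN`).  Sums over the
virtual graph reduce to sums over `G` (`sum_virt_eq_sum_ext`).  Own work; std axioms.
-/

namespace Summit.Ventures.PercRepro2

namespace NoPocket

open Finset Classical OneColourSwitch SideSwitch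

variable {V : Type*} {E : Type*} {ends : E → Sym2 V} {p q r s d b : V} {ω : Config E}

section Outside

/-- **No `W`-link at a `K`-only point of a non-linking graph**: a `W`-path from `r` to `s`
avoids `d` (`d ∉ M₂`) and the neighbours of `d` (a neighbour on it would be doubly reached or
put `d` into `M₂`), so it is an `r`–`s` path of `G − d` through non-neighbours of `d`. -/
lemma not_conn_compl_rs_of_sepN (hdr : d ≠ r) (hds : d ≠ s)
    (hsepN : ¬ Conn (endsD ends d) (chi (endsD ends d)
      ({x : V | ∀ e, ends e ≠ s(d, x)} ∪ {r, s})) r s)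
    (hM : d ∉ M2 ends r s ω)
    (hD : ∀ x, x ≠ r → x ≠ s → x ≠ d →
      (Conn ends ω r x ∨ Conn ends ω s x ∨ Conn ends ω d x) → x ∉ M2 ends r s ω) :
    ¬ Conn ends (OneColourSwitch.compl ω) r s := by
  intro h
  apply hsepN
  have key : s ∈ {z | z ≠ d ∧ z ∈ ({x : V | ∀ e, ends e ≠ s(d, x)} ∪ {r, s} : Set V) ∧
      Conn ends (OneColourSwitch.compl ω) r z ∧
      Conn (endsD ends d) (chi (endsD ends d) ({x : V | ∀ e, ends e ≠ s(d, x)} ∪ {r, s})) r z} := by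
    refine mem_of_conn_of_closed ?_ ⟨hdr.symm, Or.inr (Set.mem_insert r {s}), conn_refl _ _ _,
      conn_refl _ _ _⟩ h
    rintro z ⟨hzd, hzN, hrz, hrz'⟩ y hzy
    simp only [Set.mem_setOf_eq]
    obtain ⟨hne, e, he, hends⟩ := openGraph_adj.1 hzy
    have hry : Conn ends (OneColourSwitch.compl ω) r y :=
      conn_trans hrz (conn_of_openAdj ⟨e, he, hends⟩)
    have hyM : y ∈ M2 ends r s ω := by
      rw [M2, ← K2, mem_K2_iff]; exact Or.inl hry
    have hyd : y ≠ d := by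
      rintro rfl
      exact hM hyM
    have hyN : y ∈ ({x : V | ∀ e, ends e ≠ s(d, x)} ∪ {r, s} : Set V) := by
      by_cases hyr : y = r
      · exact Or.inr (by rw [hyr]; exact Set.mem_insert r {s})
      by_cases hys : y = s
      · exact Or.inr (by rw [hys]; exact Set.mem_insert_of_mem r rfl)
      refine Or.inl ?_
      intro e' he'
      by_cases hc : ω e' = true
      · -- a `Y`-edge `d y`: `y` is `Y`-reached from `d`, hence not in `M₂`
        exact hD y hyr hys hyd (Or.inr (Or.inr (conn_of_openAdj ⟨e', hc, he'⟩))) hyM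
      · -- a `W`-edge `d y`: `d ∈ M₂`
        apply hM
        rw [M2, ← K2, mem_K2_iff]
        refine Or.inl (conn_trans hry (conn_of_openAdj ⟨e', ?_, by rw [he', Sym2.eq_swap]⟩))
        simp only [OneColourSwitch.compl]
        rw [Bool.not_eq_true] at hc
        rw [hc]; rfl
    refine ⟨hyd, hyN, hry, conn_trans hrz' (conn_of_openAdj ⟨e, ?_, ?_⟩)⟩
    · rw [chi_eq_true_iff]
      refine ⟨z, hzN, y, hyN, ?_⟩
      rw [endsD_of_notMem (notMem_of_ends_ne hends hzd hyd), hends]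
    · rw [endsD_of_notMem (notMem_of_ends_ne hends hzd hyd), hends]
  exact key.2.2.2

/-- **`σ_rs` at a `K`-only point of a non-linking graph** is the `Y`-link indicator. -/
lemma sigma_rs_eq_of_sepN (hdr : d ≠ r) (hds : d ≠ s)
    (hsepN : ¬ Conn (endsD ends d) (chi (endsD ends d)
      ({x : V | ∀ e, ends e ≠ s(d, x)} ∪ {r, s})) r s)
    (hM : d ∉ M2 ends r s ω)
    (hD : ∀ x, x ≠ r → x ≠ s → x ≠ d →
      (Conn ends ω r x ∨ Conn ends ω s x ∨ Conn ends ω d x) → x ∉ M2 ends r s ω) :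
    sigma ends ω r s = if Conn ends ω r s then 1 else 0 := by
  unfold sigma
  rw [if_neg (not_conn_compl_rs_of_sepN hdr hds hsepN hM hD), sub_zero]

/-- **With `d ∈ K₂`, the outside conditions are the `K`-only legal conditions.** -/
lemma konly_iff_outside (hK : d ∈ K2 ends r s ω) :
    (sep2 ends p q r s ω ∧ DOne ends r s d ω ∧ d ∈ K2 ends r s ω ∧ d ∉ M2 ends r s ω) ↔
      (sep2 ends p q r s ω ∧ ¬ Conn ends ω p d ∧ ¬ Conn ends ω q d ∧
        (∀ x, x ≠ r → x ≠ s → x ≠ d →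
          (Conn ends ω r x ∨ Conn ends ω s x ∨ Conn ends ω d x) → x ∉ M2 ends r s ω) ∧
        d ∉ M2 ends r s ω) := by
  have hKx : ∀ x, (Conn ends ω r x ∨ Conn ends ω s x ∨ Conn ends ω d x) ↔ x ∈ K2 ends r s ω := by
    intro x
    rw [mem_K2_iff]
    constructor
    · rintro (h | h | h)
      · exact Or.inl h
      · exact Or.inr h
      · rcases mem_K2_iff.1 hK with h' | h'
        · exact Or.inl (conn_trans h' h)
        · exact Or.inr (conn_trans h' h)
    · rintro (h | h)
      · exact Or.inl h
      · exact Or.inr (Or.inl h)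
  constructor
  · rintro ⟨hsep, hD, -, hM⟩
    refine ⟨hsep, ?_, ?_, ?_, hM⟩
    · intro h
      rcases mem_K2_iff.1 hK with h' | h'
      · exact hsep.1.1 (conn_trans h (conn_symm h'))
      · exact hsep.1.2.1 (conn_trans h (conn_symm h'))
    · intro h
      rcases mem_K2_iff.1 hK with h' | h'
      · exact hsep.1.2.2.1 (conn_trans h (conn_symm h'))
      · exact hsep.1.2.2.2 (conn_trans h (conn_symm h'))
    · intro x hxr hxs hxd hxK
      exact hD x hxr hxs hxd ((hKx x).1 hxK)
  · rintro ⟨hsep, -, -, hD, hM⟩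
    refine ⟨hsep, ?_, hK, hM⟩
    intro x hxr hxs hxd hxK
    exact hD x hxr hxs hxd ((hKx x).2 hxK)

/-- **With `d ∈ K₂`, the outside defect is the `W`-defect.** -/
lemma WDefect_iff_outside (hK : d ∈ K2 ends r s ω) :
    WDefect ends p q r s d ω ↔
      (Conn ends (OneColourSwitch.compl ω) d p ∨ Conn ends (OneColourSwitch.compl ω) d q ∨
        ∃ x, x ≠ r ∧ x ≠ s ∧ x ≠ d ∧ (Conn ends ω r x ∨ Conn ends ω s x ∨ Conn ends ω d x) ∧
          Conn ends (OneColourSwitch.compl ω) d x) := by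
  unfold WDefect
  have hKx : ∀ x, (Conn ends ω r x ∨ Conn ends ω s x ∨ Conn ends ω d x) ↔ x ∈ K2 ends r s ω := by
    intro x
    rw [mem_K2_iff]
    constructor
    · rintro (h | h | h)
      · exact Or.inl h
      · exact Or.inr h
      · rcases mem_K2_iff.1 hK with h' | h'
        · exact Or.inl (conn_trans h' h)
        · exact Or.inr (conn_trans h' h)
    · rintro (h | h)
      · exact Or.inl h
      · exact Or.inr (Or.inl h)
  simp only [hKx]

/-- Two `Y`-links through `d` give the direct link (transitivity). -/
lemma conn_rs_of_conn_rd_sd (h1 : Conn ends ω r d) (h2 : Conn ends ω d s) : Conn ends ω r s :=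
  conn_trans h1 h2

end Outside

section Virtual

variable (hb : b = r ∨ b = s)

include hb in
/-- **The outside conditions are the `K`-only legal conditions of the virtual graph**
`G + {d, b}` with the new edge `Y`. -/
lemma konly_virt_iff_outside :
    (sep2 (fun e : Option E => e.elim s(d, b) ends) p q r s (fun e : Option E => e.elim true ω) ∧
      DOne (fun e : Option E => e.elim s(d, b) ends) r s d (fun e : Option E => e.elim true ω) ∧
      d ∈ K2 (fun e : Option E => e.elim s(d, b) ends) r s (fun e : Option E => e.elim true ω) ∧
      d ∉ M2 (fun e : Option E => e.elim s(d, b) ends) r s (fun e : Option E => e.elim true ω)) ↔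
    (sep2 ends p q r s ω ∧ ¬ Conn ends ω p d ∧ ¬ Conn ends ω q d ∧
      (∀ x, x ≠ r → x ≠ s → x ≠ d →
        (Conn ends ω r x ∨ Conn ends ω s x ∨ Conn ends ω d x) → x ∉ M2 ends r s ω) ∧
      d ∉ M2 ends r s ω) := by
  rw [sep2_virt_iff hb, DOne_virt_iff hb, d_mem_M2_virt_iff]
  constructor
  · rintro ⟨⟨h1, h2, h3⟩, h4, -, h5⟩
    exact ⟨h1, h2, h3, h4, h5⟩
  · rintro ⟨h1, h2, h3, h4, h5⟩
    exact ⟨⟨h1, h2, h3⟩, h4, d_mem_K2_virt hb, h5⟩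

/-- **`σ_rs` of the virtual graph at a point without `W`-link** is the `Y`-link indicator through
the new edge. -/
lemma sigma_rs_virt_eq_of_not_compl (hW : ¬ Conn ends (OneColourSwitch.compl ω) r s) :
    sigma (fun e : Option E => e.elim s(d, b) ends) (fun e : Option E => e.elim true ω) r s =
      if (Conn ends ω r s ∨ (Conn ends ω r d ∧ Conn ends ω b s) ∨
          (Conn ends ω r b ∧ Conn ends ω d s)) then 1 else 0 := by
  rw [sigma_rs_virt_eq, if_neg hW, sub_zero]

/-- The join through the new edge `{d, r}`: `r ~ s` or `d ~ s`. -/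
lemma join_r_iff :
    (Conn ends ω r s ∨ (Conn ends ω r d ∧ Conn ends ω r s) ∨ (Conn ends ω r r ∧ Conn ends ω d s))
      ↔ (Conn ends ω r s ∨ Conn ends ω d s) := by
  constructor
  · rintro (h | ⟨_, h⟩ | ⟨_, h⟩)
    · exact Or.inl h
    · exact Or.inl h
    · exact Or.inr h
  · rintro (h | h)
    · exact Or.inl h
    · exact Or.inr (Or.inr ⟨conn_refl _ _ _, h⟩)

/-- The join through the new edge `{d, s}`: `r ~ s` or `r ~ d`. -/
lemma join_s_iff :
    (Conn ends ω r s ∨ (Conn ends ω r d ∧ Conn ends ω s s) ∨ (Conn ends ω r s ∧ Conn ends ω d s))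
      ↔ (Conn ends ω r s ∨ Conn ends ω r d) := by
  constructor
  · rintro (h | ⟨h, _⟩ | ⟨h, _⟩)
    · exact Or.inl h
    · exact Or.inr h
    · exact Or.inl h
  · rintro (h | h)
    · exact Or.inl h
    · exact Or.inr (Or.inl ⟨h, conn_refl _ _ _⟩)

variable [Fintype E] [DecidableEq E]

/-- **A sum over the colourings of the virtual graph that vanishes when the new edge is `W`
is a sum over the colourings of `G`** (the extension with the new edge `Y`). -/
lemma sum_virt_eq_sum_ext (g : Config (Option E) → ℤ) (hg : ∀ ωp, ωp none = false → g ωp = 0) :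
    ∑ ωp : Config (Option E), g ωp = ∑ ω : Config E, g (fun e : Option E => e.elim true ω) := by
  rw [← (Equiv.piOptionEquivProd (β := fun _ : Option E => Bool)).symm.sum_comp,
    Fintype.sum_prod_type, Fintype.sum_bool]
  have h0 : ∀ ω : Config E, g ((Equiv.piOptionEquivProd (β := fun _ : Option E => Bool)).symm
      (false, ω)) = 0 := fun ω => hg _ rfl
  simp only [h0, Finset.sum_const_zero, add_zero]
  refine Finset.sum_congr rfl fun ω _ => ?_
  congr 1
  funext e
  rcases e with _ | e <;> rfl

end Virtual

end NoPocket

end Summit.Ventures.PercRepro2
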